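import Mathlib
import Summits.HodgeConjecture.HodgeConjecture.Theorems.HodgeLocusCensusModelJumpFamily
import Summits.HodgeConjecture.HodgeConjecture.Theorems.HodgeLocusCensusModelJumpWitness

/-!
# Hodge-locus census — THE RANK 'PAPER STEPS' (α)(β)(γ) OF THE K-MODEL ANCHORS AS KERNEL THEOREMS OVER AN ARBITRARY FIELD
(def-free, certificate-free, theorem-only helper of `stmt-HodgeConjecture-16267`; pub-hlocus, seat ivhs-2 = ENGINE B, gen 43, item B43-R;
record `pub-hlocus-ivhs-2/ENGINEB-g43.md`; companion of the ENGINE B gen-31 anchors `HodgeLocusCensusModelJumpFamily.lean` (THEOREM K-MODEL: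
the infinite jump family `F_{d;1,2}` of the cells `(4,d,1)`) and `HodgeLocusCensusModelJumpWitness.lean` (COROLLARY K-GEN: the witness
`F′_d`), whose `basis`, `suppMul`, `suppMul_basis`, `suppMulW`, `suppMulW_basis`, `pattern_det` are APPLIED here by name; nothing of theirs
is restated.)

What the two anchors left as words.  Both anchors kernel-check, for ALL `d`, the COLUMN SUPPORTS of the multiplication maps
`×δ, ×δ′ : B_{d-4} → B_{2d-6}` (`B = K[x₁,x₂]/(x₁^{d-1}, x₂^{d-1})`, `δ = x₁^{d-2} + x₂^{d-2}`, `δ′ = δ + x₁x₂^{d-3}`; every listed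
monomial has coefficient `1`) and then conclude the RANK by a 'paper step' their docstrings name and do not prove:
(α) `ModelJumpFamily`: "a 0/1 matrix whose columns have pairwise distinct singleton supports has rank = number of nonzero columns" ⇒ `ρ(F_{d;1,2}) = 2`;
(β) `ModelJumpWitness`: "a nonzero 3×3 minor in a matrix with 3 rows gives rank 3" ⇒ `ρ(F′_d) = 3`;
(γ) `ModelNonJumpC1All`: "a 0/1 matrix whose nonzero columns are unit vectors covering every row has full row rank".

This file proves, with `Matrix.rank` of Mathlib and over an ARBITRARY field `K`:
* LAYER A (general, no dimension-specific hypothesis): `rank_le_card_of_rows_eq_zero` (rows outside the image of `r : ι → m` vanish ⇒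
  `rank ≤ |ι|`), `card_le_rank_of_unit_cols` (`|ι|` columns equal to the distinct unit vectors `e_{r s}` ⇒ `|ι| ≤ rank`),
  `card_le_rank_of_det_ne_zero` (a nonzero `|ι| × |ι|` minor ⇒ `|ι| ≤ rank`), and the three paper steps as corollaries:
  (γ) `rank_eq_card_of_covering_unit_cols`, (α) `rank_eq_card_of_zero_or_unit_cols`, (β) `rank_eq_card_of_det_ne_zero`
  (tools: Mathlib's `Matrix.rank_submatrix_le`, `rank_one`, `rank_of_isUnit`, `rank_le_card_height`, `rank_eq_finrank_span_row`,
  `finrank_range_le_card`).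
* LAYER B (the two all-`d` instances, each ONE theorem): the matrix of `×δ` (resp. `×δ′`) in the anchors' monomial bases — rows
  `t : Fin 3 ↦ x₁^{d-2-t} x₂^{d-4+t}` (the anchors' docstring order `x₁^{d-2}x₂^{d-4}, x₁^{d-3}x₂^{d-3}, x₁^{d-4}x₂^{d-2}` of the basis of
  `B_{2d-6}`), columns `i : Fin (d-3) ↦ x₁^i x₂^{d-4-i}` (the basis of `B_{d-4}`), entry `1` if the row monomial occurs in the anchor's
  support list `suppMul d (i, d-4-i)` (resp. `suppMulW d (i, d-4-i)`) of the column's image and `0` otherwise — has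
  `Matrix.rank = 2` for EVERY `d ≥ 5` (`rank_mulDelta_modelJumpFamily`, by (α) from `suppMul_basis`) and `Matrix.rank = 3` for EVERY
  `d ≥ 6` (`rank_mulDelta_modelJumpWitness`, by (β): in the columns `(0, d-5, d-4)` the matrix IS the anchor's pattern
  `!![1,0,0; 0,0,1; 0,1,1]`, whose determinant `-1` is imported from `pattern_det` through `Int.cast`).
  The bridge lemmas `mem_basis_source_iff`, `mem_basis_target_iff`, `basis_nodup`, `length_basis_source` (`dim B_{d-4} = d-3`, all `d ≥ 4`),
  `length_basis_target` (`dim B_{2d-6} = 3`, all `d ≥ 5`) certify that these row/column index types enumerate the anchors' `basis` lists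
  exactly (the anchors had the two lengths for `d = 5..16` by `decide`); the indicator entry is the coefficient because the support lists
  are duplicate-free (the terms of `δ`, `δ′` are distinct monomials).  Consequence, all `d ≥ 6` (`rank_lt_min_modelJumpFamily`,
  `rank_eq_min_modelJumpWitness`): `ρ(F_{d;1,2}) = 2 < 3 = min(dim B_{d-4}, dim B_{2d-6})` — the model member is rank-deficient — while the
  K-GEN witness attains the maximum `3`; at `d = 5`, `ρ = 2` is the maximum (`min(2,3)`).

Scope (said plainly).  These are statements about explicit 0/1 matrices read off the anchors' support lists; that `ρ` is the rank entering
THEOREM K⁼ (`b = H_B(t-d) - ρ`, hence `b(F_{d;1,2}) = 1 = b_gen + 1` for `d ≥ 6`) is the record's seat-proved, LEAD/referee-read step and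
stays outside Lean, as in the anchors.  Evidence-class upgrade of existing record statements only; no census number changes; nothing about
Hodge loci beyond the K-MODEL record; nothing about HC.  The instance (γ) for `ModelNonJumpC1All` (`c′ = 1`, every `k′ ≥ 3`) is NOT
treated here (its index types are exponent lists of symbolic length); LAYER A's `rank_eq_card_of_covering_unit_cols` is the general lemma it needs.

certified instances and evidence bearing on the general Hodge conjecture; no claim.
-/

set_option linter.dupNamespace false
set_option autoImplicit false

namespace Summit.HodgeConjecture.HodgeConjecture.HodgeLocus.Census.UnitColumnRank

open Summit.HodgeConjecture.HodgeConjecture.HodgeLocus.Census.ModelJumpFamily (basis suppMul suppMul_basis)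
open Summit.HodgeConjecture.HodgeConjecture.HodgeLocus.Census.ModelJumpWitness (suppMulW suppMulW_basis pattern_det)

/-! ## LAYER A — general rank lemmas over an arbitrary field -/

section LayerA

variable {K : Type*} [Field K] {m n ι : Type*} [Fintype n] [Fintype ι]

/-- UPPER BOUND BY NONZERO ROWS: if every row of `A` outside the image of `r : ι → m` vanishes, then `rank A ≤ |ι|`
(the rows of `A` span a subspace of the span of the `|ι|` rows `A (r s)`). -/
theorem rank_le_card_of_rows_eq_zero [Fintype m] (A : Matrix m n K) (r : ι → m)
    (h0 : ∀ i, i ∉ Set.range r → A i = 0) : A.rank ≤ Fintype.card ι := by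
  rw [Matrix.rank_eq_finrank_span_row]
  have hsub : Set.range A.row ⊆ insert 0 (Set.range (fun s => A.row (r s))) := by
    rintro _ ⟨i, rfl⟩
    by_cases hi : i ∈ Set.range r
    · obtain ⟨s, rfl⟩ := hi
      exact Set.mem_insert_of_mem _ ⟨s, rfl⟩
    · have : A.row i = 0 := h0 i hi
      rw [this]
      exact Set.mem_insert _ _
  calc Module.finrank K (Submodule.span K (Set.range A.row))
      ≤ Module.finrank K (Submodule.span K (insert 0 (Set.range (fun s => A.row (r s))))) :=
        Submodule.finrank_mono (Submodule.span_mono hsub)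
    _ = Module.finrank K (Submodule.span K (Set.range (fun s => A.row (r s)))) := by
        rw [Submodule.span_insert_zero]
    _ ≤ Fintype.card ι := finrank_range_le_card _

/-- LOWER BOUND BY UNIT COLUMNS: if for an injective `r : ι → m` the columns `c s` of `A` are the unit vectors `e_{r s}`, then
`|ι| ≤ rank A` (the submatrix on rows `r`, columns `c` is the identity, and `Matrix.rank_submatrix_le`). -/
theorem card_le_rank_of_unit_cols [DecidableEq m] [DecidableEq ι] (A : Matrix m n K) (r : ι → m)
    (hr : Function.Injective r) (c : ι → n) (hc : ∀ s i, A i (c s) = if i = r s then 1 else 0) :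
    Fintype.card ι ≤ A.rank := by
  have h1 : A.submatrix r c = 1 := by
    ext s' s
    simp [hc, Matrix.one_apply, hr.eq_iff]
  calc Fintype.card ι = (A.submatrix r c).rank := by rw [h1, Matrix.rank_one]
    _ ≤ A.rank := Matrix.rank_submatrix_le A r c

/-- LOWER BOUND BY A MINOR: a nonzero `|ι| × |ι|` minor (rows `r`, columns `c`) gives `|ι| ≤ rank A`. -/
theorem card_le_rank_of_det_ne_zero [DecidableEq ι] (A : Matrix m n K) (r : ι → m) (c : ι → n)
    (h : (A.submatrix r c).det ≠ 0) : Fintype.card ι ≤ A.rank := by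
  calc Fintype.card ι = (A.submatrix r c).rank :=
        (Matrix.rank_of_isUnit _ ((Matrix.isUnit_iff_isUnit_det _).mpr (isUnit_iff_ne_zero.mpr h))).symm
    _ ≤ A.rank := Matrix.rank_submatrix_le A r c

/-- PAPER STEP (γ) — covering unit columns ⇒ full row rank: if every row index `s` owns a column `c s` equal to the unit vector `e_s`,
then `rank A = number of rows`. -/
theorem rank_eq_card_of_covering_unit_cols [Fintype m] [DecidableEq m] (A : Matrix m n K) (c : m → n)
    (hc : ∀ s i, A i (c s) = if i = s then 1 else 0) : A.rank = Fintype.card m :=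
  le_antisymm (Matrix.rank_le_card_height A) (card_le_rank_of_unit_cols A id Function.injective_id c hc)

/-- PAPER STEP (α) — zero-or-distinct unit columns ⇒ rank = number of distinct unit columns: if the columns `c s` are the distinct
unit vectors `e_{r s}` (`r` injective) and EVERY column is zero or one of these unit vectors, then `rank A = |ι|`. -/
theorem rank_eq_card_of_zero_or_unit_cols [Fintype m] [DecidableEq m] [DecidableEq ι] (A : Matrix m n K) (r : ι → m)
    (hr : Function.Injective r) (c : ι → n) (hc : ∀ s i, A i (c s) = if i = r s then 1 else 0)
    (hcol : ∀ j, (∀ i, A i j = 0) ∨ ∃ s, ∀ i, A i j = if i = r s then 1 else 0) :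
    A.rank = Fintype.card ι := by
  refine le_antisymm (rank_le_card_of_rows_eq_zero A r ?_) (card_le_rank_of_unit_cols A r hr c hc)
  intro i hi
  funext j
  rcases hcol j with h | ⟨s, h⟩
  · exact h i
  · rw [h i, if_neg]
    · rfl
    · rintro rfl
      exact hi ⟨s, rfl⟩

/-- PAPER STEP (β) — a nonzero maximal minor ⇒ full row rank: if some choice `c` of one column per row gives a square submatrix with
nonzero determinant, then `rank A = number of rows`. -/
theorem rank_eq_card_of_det_ne_zero [Fintype m] [DecidableEq m] (A : Matrix m n K) (c : m → n)
    (h : (A.submatrix id c).det ≠ 0) : A.rank = Fintype.card m :=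
  le_antisymm (Matrix.rank_le_card_height A) (card_le_rank_of_det_ne_zero A id c h)

end LayerA

/-! ## Bridge — the row/column index types enumerate the anchors' monomial bases -/

/-- the COLUMN index `i : Fin (d-3)` enumerates the anchor's monomial basis of `B_{d-4}` (`x₁^i x₂^{d-4-i}`), every `d ≥ 5`. -/
theorem mem_basis_source_iff (d : ℕ) (hd : 5 ≤ d) (e : ℕ × ℕ) :
    e ∈ basis d (d - 4) ↔ ∃ i : Fin (d - 3), e = ((i : ℕ), d - 4 - (i : ℕ)) := by
  unfold basis
  simp only [List.mem_map, List.mem_filter, List.mem_range, decide_eq_true_eq]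
  constructor
  · rintro ⟨i, ⟨hi, -, -⟩, rfl⟩
    exact ⟨⟨i, by omega⟩, rfl⟩
  · rintro ⟨⟨i, hi⟩, rfl⟩
    exact ⟨i, ⟨by omega, by omega, by omega⟩, rfl⟩

/-- the ROW index `t : Fin 3` enumerates the anchor's monomial basis of `B_{2d-6}` (`x₁^{d-2-t} x₂^{d-4+t}`), every `d ≥ 5`. -/
theorem mem_basis_target_iff (d : ℕ) (hd : 5 ≤ d) (e : ℕ × ℕ) :
    e ∈ basis d (2 * d - 6) ↔ ∃ t : Fin 3, e = (d - 2 - (t : ℕ), d - 4 + (t : ℕ)) := by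
  unfold basis
  simp only [List.mem_map, List.mem_filter, List.mem_range, decide_eq_true_eq]
  constructor
  · rintro ⟨i, ⟨hi, h1, h2⟩, rfl⟩
    refine ⟨⟨d - 2 - i, by omega⟩, ?_⟩
    simp only [Prod.mk.injEq]
    omega
  · rintro ⟨⟨t, ht⟩, rfl⟩
    refine ⟨d - 2 - t, ⟨by omega, by omega, by omega⟩, ?_⟩
    simp only [Prod.mk.injEq, true_and]
    omega

/-- the anchor's basis lists repeat no monomial (so the two enumerations above are bijections onto them). -/
theorem basis_nodup (d j : ℕ) : (basis d j).Nodup := by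
  unfold basis
  refine List.Nodup.map ?_ (List.Nodup.filter _ List.nodup_range)
  intro a b h
  exact ((Prod.mk.injEq _ _ _ _).mp h).1

/-- `dim B_{d-4} = d - 3` (the number of columns) for every `d ≥ 4`. -/
theorem length_basis_source (d : ℕ) (hd : 4 ≤ d) : (basis d (d - 4)).length = d - 3 := by
  unfold basis
  rw [List.length_map, List.filter_eq_self.mpr, List.length_range]
  · omega
  · intro i hi
    simp only [List.mem_range] at hi
    simp only [decide_eq_true_eq]
    omega

/-- `dim B_{2d-6} = 3` (the number of rows) for every `d ≥ 5`. -/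
theorem length_basis_target (d : ℕ) (hd : 5 ≤ d) : (basis d (2 * d - 6)).length = 3 := by
  rw [← List.toFinset_card_of_nodup (basis_nodup d _)]
  have h : (basis d (2 * d - 6)).toFinset =
      (Finset.univ : Finset (Fin 3)).image (fun t : Fin 3 => (d - 2 - (t : ℕ), d - 4 + (t : ℕ))) := by
    ext e
    simp only [List.mem_toFinset, mem_basis_target_iff d hd, Finset.mem_image, Finset.mem_univ, true_and,
      eq_comm]
  rw [h, Finset.card_image_of_injective _ ?_]
  · simp
  · intro a b hab
    have := (Prod.mk.injEq _ _ _ _).mp hab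
    apply Fin.ext
    omega

/-! ## The anchors' column supports in row coordinates -/

/-- `×δ`, every `d ≥ 5` (from `suppMul_basis`): the row monomial `x₁^{d-2-t}x₂^{d-4+t}` occurs in the image of the column monomial
`x₁^i x₂^{d-4-i}` iff `(i, t) = (0, 0)` or `(i, t) = (d-4, 2)`. -/
theorem mem_suppMul_row_iff (d : ℕ) (hd : 5 ≤ d) (t : Fin 3) (i : Fin (d - 3)) :
    ((d - 2 - (t : ℕ), d - 4 + (t : ℕ)) ∈ suppMul d ((i : ℕ), d - 4 - (i : ℕ))) ↔
      (((i : ℕ) = 0 ∧ (t : ℕ) = 0) ∨ ((i : ℕ) = d - 4 ∧ (t : ℕ) = 2)) := by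
  have ht := t.2
  have hi := i.2
  rw [suppMul_basis d i hd (by omega)]
  simp only [List.mem_append, List.mem_ite_nil_right, List.mem_singleton, Prod.mk.injEq]
  omega

/-- `×δ′`, every `d ≥ 6` (from `suppMulW_basis`): the row monomial `x₁^{d-2-t}x₂^{d-4+t}` occurs in the image of `x₁^i x₂^{d-4-i}` iff
`(i, t) ∈ {(0, 0), (d-4, 2), (d-5, 2), (d-4, 1)}`. -/
theorem mem_suppMulW_row_iff (d : ℕ) (hd : 6 ≤ d) (t : Fin 3) (i : Fin (d - 3)) :
    ((d - 2 - (t : ℕ), d - 4 + (t : ℕ)) ∈ suppMulW d ((i : ℕ), d - 4 - (i : ℕ))) ↔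
      (((i : ℕ) = 0 ∧ (t : ℕ) = 0) ∨ ((i : ℕ) = d - 4 ∧ (t : ℕ) = 2) ∨
        ((i : ℕ) = d - 5 ∧ (t : ℕ) = 2) ∨ ((i : ℕ) = d - 4 ∧ (t : ℕ) = 1)) := by
  have ht := t.2
  have hi := i.2
  rw [suppMulW_basis d i hd (by omega)]
  simp only [List.mem_append, List.mem_ite_nil_right, List.mem_singleton, Prod.mk.injEq]
  omega

/-! ## LAYER B — the two all-`d` instances -/

/-- THEOREM K-MODEL, jump family, EVERY `d ≥ 5`: the matrix of `×δ : B_{d-4} → B_{2d-6}` of `F_{d;1,2}` in the monomial bases has rank `2`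
over every field (paper step (α): its columns `0` and `d-4` are the distinct unit vectors of the rows `x₁^{d-2}x₂^{d-4}` and
`x₁^{d-4}x₂^{d-2}`, every other column is zero). -/
theorem rank_mulDelta_modelJumpFamily (K : Type*) [Field K] (d : ℕ) (hd : 5 ≤ d) :
    (Matrix.of fun (t : Fin 3) (i : Fin (d - 3)) =>
      if ((d - 2 - (t : ℕ), d - 4 + (t : ℕ)) ∈ suppMul d ((i : ℕ), d - 4 - (i : ℕ))) then (1 : K) else 0).rank = 2 := by
  have e := rank_eq_card_of_zero_or_unit_cols (K := K) (ι := Fin 2)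
    (Matrix.of fun (t : Fin 3) (i : Fin (d - 3)) =>
      if ((d - 2 - (t : ℕ), d - 4 + (t : ℕ)) ∈ suppMul d ((i : ℕ), d - 4 - (i : ℕ))) then (1 : K) else 0)
    ![0, 2] (by decide) ![⟨0, by omega⟩, ⟨d - 4, by omega⟩] ?_ ?_
  · simpa using e
  · intro s t
    fin_cases s <;> fin_cases t <;> simp [mem_suppMul_row_iff d hd] <;> omega
  · intro j
    have hj := j.2
    by_cases h0 : (j : ℕ) = 0
    · right; refine ⟨0, ?_⟩; intro t; fin_cases t <;> simp [mem_suppMul_row_iff d hd] <;> omega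
    · by_cases h4 : (j : ℕ) = d - 4
      · right; refine ⟨1, ?_⟩; intro t; fin_cases t <;> simp [mem_suppMul_row_iff d hd] <;> omega
      · left; intro t; simp [mem_suppMul_row_iff d hd]; omega

/-- COROLLARY K-GEN witness, EVERY `d ≥ 6`: the matrix of `×δ′ : B_{d-4} → B_{2d-6}` of `F′_d` in the monomial bases has rank `3` over
every field (paper step (β): on the columns `(0, d-5, d-4)` it is the anchor's pattern `!![1,0,0; 0,0,1; 0,1,1]`, of determinant `-1` by
`pattern_det`). -/
theorem rank_mulDelta_modelJumpWitness (K : Type*) [Field K] (d : ℕ) (hd : 6 ≤ d) :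
    (Matrix.of fun (t : Fin 3) (i : Fin (d - 3)) =>
      if ((d - 2 - (t : ℕ), d - 4 + (t : ℕ)) ∈ suppMulW d ((i : ℕ), d - 4 - (i : ℕ))) then (1 : K) else 0).rank = 3 := by
  set W : Matrix (Fin 3) (Fin (d - 3)) K := Matrix.of fun (t : Fin 3) (i : Fin (d - 3)) =>
      if ((d - 2 - (t : ℕ), d - 4 + (t : ℕ)) ∈ suppMulW d ((i : ℕ), d - 4 - (i : ℕ))) then (1 : K) else 0 with hW
  have hsub : W.submatrix id ![⟨0, by omega⟩, ⟨d - 5, by omega⟩, ⟨d - 4, by omega⟩] =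
      (Int.castRingHom K).mapMatrix !![(1 : ℤ), 0, 0; 0, 0, 1; 0, 1, 1] := by
    ext t s
    fin_cases t <;> fin_cases s <;> simp [hW, mem_suppMulW_row_iff d hd] <;> omega
  have hdet : (W.submatrix id ![⟨0, by omega⟩, ⟨d - 5, by omega⟩, ⟨d - 4, by omega⟩]).det = -1 := by
    rw [hsub, ← RingHom.map_det, pattern_det]
    simp
  have h := rank_eq_card_of_det_ne_zero W _ (by rw [hdet]; norm_num)
  simpa using h

/-- EVERY `d ≥ 6`: `ρ(F_{d;1,2}) = 2` is STRICTLY below `min(dim B_{d-4}, dim B_{2d-6}) = 3`, the largest rank a map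
`B_{d-4} → B_{2d-6}` can have (the model member is rank-deficient; at `d = 5` the minimum is `2 = ρ`). -/
theorem rank_lt_min_modelJumpFamily (K : Type*) [Field K] (d : ℕ) (hd : 6 ≤ d) :
    (Matrix.of fun (t : Fin 3) (i : Fin (d - 3)) =>
      if ((d - 2 - (t : ℕ), d - 4 + (t : ℕ)) ∈ suppMul d ((i : ℕ), d - 4 - (i : ℕ))) then (1 : K) else 0).rank = 2 ∧
    min (basis d (d - 4)).length (basis d (2 * d - 6)).length = 3 ∧
    min (basis 5 (5 - 4)).length (basis 5 (2 * 5 - 6)).length = 2 := by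
  refine ⟨rank_mulDelta_modelJumpFamily K d (by omega), ?_, by decide⟩
  rw [length_basis_source d (by omega), length_basis_target d (by omega)]
  omega

/-- EVERY `d ≥ 6`: the K-GEN witness attains the maximum, `ρ(F′_d) = 3 = min(dim B_{d-4}, dim B_{2d-6})`. -/
theorem rank_eq_min_modelJumpWitness (K : Type*) [Field K] (d : ℕ) (hd : 6 ≤ d) :
    (Matrix.of fun (t : Fin 3) (i : Fin (d - 3)) =>
      if ((d - 2 - (t : ℕ), d - 4 + (t : ℕ)) ∈ suppMulW d ((i : ℕ), d - 4 - (i : ℕ))) then (1 : K) else 0).rank =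
    min (basis d (d - 4)).length (basis d (2 * d - 6)).length := by
  rw [rank_mulDelta_modelJumpWitness K d hd, length_basis_source d (by omega), length_basis_target d (by omega)]
  omega

end Summit.HodgeConjecture.HodgeConjecture.HodgeLocus.Census.UnitColumnRank
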